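import Mathlib.LinearAlgebra.TensorProduct.Basic
import Mathlib.Algebra.Group.TypeTags.Basic
import Mathlib.Algebra.Ring.Action.Basic
import Mathlib.Algebra.BigOperators.Group.Finset.Basic
import Mathlib.GroupTheory.GroupAction.Defs
import Mathlib.LinearAlgebra.FreeModule.Basic
import Mathlib.RingTheory.Finiteness.Defs
import Mathlib.RepresentationTheory.Homological.GroupCohomology.LowDegree
import Literature.NumberTheory.Automorphic.LParameter
import HarnessLib

/-!
# Langlands–Shelstad, *On the definition of transfer factors* (1987) — SHARED CARRIERS (`Defs`)
# for §1 (Preliminaries) and §2 (Key Lemmas): the gauge ∕ a-data cochains of (2.1)–(2.2) as GENUINE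
# Mathlib objects, the endoscopic datum of (1.2) over the tree's `LGroupData`, and the point-correspondence
# vocabulary of (1.3) as an explicit interface

Topic `Literature/NumberTheory/Automorphic/LanglandsShelstad1987/`; namespace
`Literature.NumberTheory.Automorphic.LanglandsShelstad1987` (directory-aligned, CONVENTIONS §2; carpet squad TN,
SPLIT-v1 6bf6eba45b565d8c row TN-t01).  This file holds DEFINITIONS ONLY (every `def`/`structure`/`abbrev` has a
body; no theorem, no `sorry`, no `axiom`, no `instance`, no `notation`); the numbered lemmas of §1 and §2.1–2.3 are
stated as named facts in the sibling files `Preliminaries.lean` and `KeyLemmasI.lean`, those of §2.4–2.6 and §3 in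
`KeyLemmasII.lean` ∕ `TransferFactorDefinition.lean` (TN-t02), §4/§6 (TN-t03), §5 (TN-t07) — all of which import this
file.  Source: R. P. Langlands, D. Shelstad, Math. Ann. 278 (1987) 219–271, read in the IAS reissue (58 pp.; page pins
«reissue p. N» are the pages of that reissue, held as `paper:doi-10-1007-bf01458070`).

## Part A — the abstract setting of (2.1) (reissue pp. 11–12), CONCRETE over Mathlib

Print: «Let `X` be a free finitely generated `ℤ`-module and `Σ` be a group which acts on `X` and contains an element
`ε` sending `λ` to `−λ`, `λ ∈ X`. Then with trivial action of `k^×`, `Σ` acts on `k^× ⊗ X`. Let `R` be a finite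
`Σ`-stable subset of `X` and `p` be a gauge on `R`, by which we mean that `p : R → {±1}` and `p(−λ) = −p(λ)`,
`λ ∈ R`.» and «In the application of (2.3) and (2.6) we will have `ε² = 1` and `Σ` will be the product of `{1, ε}`
and a subgroup `Γ`.»  Conventions (posted on the squad bus 2026-09-02T02:0xZ, (C1)–(C7)):
* (C1) the coefficient module «`k^× ⊗ X`» is `UnitsTensor X k := X ⊗[ℤ] Additive kˣ` — `X` on the LEFT, so that
  Mathlib's instance `TensorProduct.leftDistribMulAction` IS print's action of `Σ` through `X` with `k^×` fixed; we
  write it ADDITIVELY (print's products of `(−1)^λ`, `a_λ^λ` are sums here); print's «`a^λ ∈ k^× ⊗ X`» is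
  `unitPow a λ = λ ⊗ₜ ofMul a`, «`(−1)^λ`» is `unitPow (-1) λ`.
* (C2) `Σ` is any group `S` with `[DistribMulAction S X]`; the element `ε` enters as a hypothesis `∀ x, ε • x = -x`
  where print uses it.  The lemmas printed for the subgroup `Γ` with `Σ = Γ × {1, ε}` are stated for a group `Γ`
  acting on `X` with `R` `Γ`-stable and `−R = R` (`IsStable Γ R ∧ IsSymm R`), which is the same datum.
* (C3) `R : Finset X`; a gauge is `p : X → ℤˣ` with `IsGauge R p` (values off `R` are never read).
* (C4) `tCochain S k R p : S × S → UnitsTensor X k` is print's `t_p(σ, τ) = ∏^p_{1,σ,τ} (−1)^λ`; cocycle ∕ coboundary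
  assertions about it are Mathlib's inhomogeneous `groupCohomology.IsCocycle₂ / IsCoboundary₂ / IsCocycle₁ /
  IsCoboundary₁` for the instance action of (C1) (`∂c(σ,τ) = σ·c(τ) − c(στ) + c(σ)` = print's `u(σ)σ(u(τ))u(στ)⁻¹`).
* (C5) a-data (2.2) live in an algebraically closed `K` (print's `k̄`) on which `Γ` acts by field automorphisms
  (`[MulSemiringAction Γ K]`, print: «given an extension of the action of `Σ` on `k` to `k̄` with `ε` acting
  trivially»); the resulting DIAGONAL action on `K^× ⊗ X` cannot be a Mathlib instance and is the explicit
  `ℤ`-linear map `actDiag Γ K σ`.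
* (C6) symmetric ∕ asymmetric `Γ`-orbits (2.1, p. 12) and the stabilisers `Γ_{+λ}`, `Γ_{±λ}` of (2.5, p. 19).

## Part B — (1.2) endoscopic data (reissue p. 7) over the tree's `LGroupData`

The tree's ★ `Literature.NumberTheory.Automorphic.LGroupData F` (file `Automorphic/LParameter.lean`) is an L-group
datum `(Ĝ ≤ GL_N(ℂ), ρ_G : Γ_F → Aut Ĝ)` with `ᴸG = Ĝ ⋊ Γ_F` (`LGroupData.LGroup`, GALOIS form).  Print works with
the Weil form `Ĝ ⋊ W_F` and a split extension `ℋ` of `W_F` by `Ĥ`, then says (p. 7): «If `ℋ` is an L-group then we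
may assume that `ℋ = ᴸH`. This will be our assumption until (4.4)».  `EndoscopicDatum L` records exactly that case
in the Galois form: `(Ĥ-datum, s, ξ : ᴸH → ᴸG)` with print's (iii), (iv)(a) LOCAL («a trivial 1-cocycle of `W_F` in
`Z(Ĝ)`», read as cohomologically trivial, i.e. `a(w) = z·w(z)⁻¹` with `z ∈ Z(Ĝ)`, as in [K-S]) and (iv)(b)
(`ξ|_Ĥ` an isomorphism onto `Cent(s, Ĝ)⁰`, identity component for the complex topology of `Ĝ ≤ GL_N(ℂ)`, the
tree's idiom in `LParameter.componentGroup`).  The quasi-split `F`-group `H` itself is NOT part of the datum (no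
reductive groups over local fields in Mathlib): condition (i) «`H` is quasi-split over `F`» and the duality half of
the equivalence of data (p. 7 (i)) are therefore not expressible here and are deliberately omitted — see `IsLEquiv`.

## Part C — (1.3) point correspondences (reissue pp. 8–9) as an explicit INTERFACE

`A_{H/G} : Cℓ_ss(H(F̄)) → Cℓ_ss(G(F̄))`, `G`-regular ∕ strongly `G`-regular elements of `H(F)`, stable conjugacy and
«`γ_H` is an image of `γ_G`» need connected reductive groups over `F`, their tori and Weyl groups — none in Mathlib.
Following the squad policy (SPLIT-v1 §B: «a notion Lean lacks ⇒ ONE `structure` interface, book definition cited,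
never an axiom») `PointCorrespondence Γ HF GF` bundles these as explicit PREDICATE ∕ FUNCTION fields with NO
properties; the printed properties (Lemma 1.3.A, (1.3)(i)(ii)) are named `Prop`s ON a given interface in
`Preliminaries.lean`, to be assumed by consumers for THEIR data — `∀ P, …` is never claimed.  The transfer-factor
axioms of (1.4) are ALREADY in the tree as ★ `Literature.NumberTheory.Rogawski1990.LocalTransfer.TransferFactorData`
(Δ vanishing off matching pairs, class function), ★ `stableOrbitalIntegralRel`, ★ `IsDeltaTransferRel` (Δ-matching
orbital integrals), ★ `IsDeltaTransferExistsRel` (Δ is a transfer factor) — cited there, not restated here.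

## References
* [LanglandsShelstad1987] R. P. Langlands, D. Shelstad, *On the definition of transfer factors*, Math. Ann. 278
  (1987) 219–271; IAS reissue pp. 6–7 (1.2), 8–9 (1.3), 9–10 (1.4), 10–13 (2.1)–(2.2), 19–20 (2.5).
* [KottwitzShelstad1999] R. Kottwitz, D. Shelstad, *Foundations of twisted endoscopy*, Astérisque 255, §2.1
  (endoscopic data; the reading of «trivial 1-cocycle»).
* [Corvallis1979] A. Borel, *Automorphic L-functions*, §§2.1–2.4 (L-groups) — the tree's `LGroupData`.
-/

noncomputable section

open scoped TensorProduct Pointwise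

namespace Literature.NumberTheory.Automorphic.LanglandsShelstad1987

universe u v w

/-! ## Part A. (2.1)–(2.2): gauges, the cochains `t_p`, `u_p`, `v_p`, a-data (reissue pp. 11–13) -/

section GaugeCarriers

variable (S : Type u) [Group S] (X : Type v) [AddCommGroup X] [DistribMulAction S X]
variable (k : Type w) [Field k]

/-- Print's coefficient module «`k^× ⊗ X`» (reissue p. 11: «with trivial action of `k^×`, `Σ` acts on `k^× ⊗ X`»),
realised as `X ⊗[ℤ] Additive kˣ` (factor `X` on the left so that Mathlib's `TensorProduct.leftDistribMulAction`
is that action; additive notation).  For a torus `T` with cocharacter lattice `X = X_*(T)` this is `T(k)`.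
[cite: LanglandsShelstad1987, §2.1 (reissue p. 11)] -/
abbrev UnitsTensor : Type (max v w) := X ⊗[ℤ] Additive kˣ

variable {X k}

/-- Print's «`a^λ ∈ k^× ⊗ X`» for `a ∈ k^×`, `λ ∈ X` (reissue p. 11: «`(−1)^{α^∨} ∈ k^× ⊗ X_*(T) ⊆ T(k̄)`»;
p. 13: «`a_λ^λ`»): the pure tensor `λ ⊗ a`, additively. [cite: LanglandsShelstad1987, §2.1 (reissue p. 11)] -/
def unitPow (a : kˣ) (l : X) : UnitsTensor X k := l ⊗ₜ[ℤ] Additive.ofMul a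

variable (X) in
/-- «`R` is a finite `Σ`-stable subset of `X`» (reissue pp. 11–12). [cite: LanglandsShelstad1987, §2.1 (reissue p. 11)] -/
def IsStable (R : Finset X) : Prop := ∀ σ : S, ∀ l ∈ R, σ • l ∈ R

/-- `−R = R` — automatic in print because `ε ∈ Σ` acts by `−1`; an explicit hypothesis in the `Γ`-only statements
(convention (C2)). [cite: LanglandsShelstad1987, §2.1 (reissue pp. 11–12)] -/
def IsSymm (R : Finset X) : Prop := ∀ l ∈ R, -l ∈ R

/-- «a gauge on `R`, by which we mean that `p : R → {±1}` and `p(−λ) = −p(λ)`, `λ ∈ R`» (reissue p. 12); `p` is a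
function on all of `X` with values in `ℤˣ = {±1}`, constrained only on `R`. [cite: LanglandsShelstad1987, §2.1 (reissue p. 12)] -/
def IsGauge (R : Finset X) (p : X → ℤˣ) : Prop := ∀ l ∈ R, p (-l) = -p l

variable (k) in
/-- **`t_p(σ, τ) = ∏^p_{1,σ,τ} (−1)^λ`** (reissue p. 12, display before Lemma 2.1.B), the product (here: sum) over
those `λ ∈ R` with `p(λ) = 1`, `p(σ⁻¹λ) = −1`, `p(τ⁻¹σ⁻¹λ) = 1`; a 2-cochain of `Σ` with values in `k^× ⊗ X`.
[cite: LanglandsShelstad1987, §2.1 (reissue p. 12)] -/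
def tCochain (R : Finset X) (p : X → ℤˣ) : S × S → UnitsTensor X k := fun στ =>
  ∑ l ∈ R with (p l = 1 ∧ p (στ.1⁻¹ • l) = -1 ∧ p (στ.2⁻¹ • στ.1⁻¹ • l) = 1), unitPow (-1 : kˣ) l

variable (X) in
/-- «`O` is symmetric»: `O` is a `Γ`-orbit in `X` with `O = −O` (reissue p. 12: «… or `Γ` also acts transitively on
`R`, in which case `R` is a `Γ`-orbit `O`, where `O = −O` … symmetric»). [cite: LanglandsShelstad1987, §2.1 (reissue p. 12)] -/
def IsSymmOrbit (O : Set X) : Prop := (∃ l : X, O = MulAction.orbit S l) ∧ -O = O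

variable (X) in
/-- «`O` is asymmetric»: `O` is a `Γ`-orbit with `−O ≠ O`, so that `±O` are two distinct `Γ`-orbits (reissue p. 12:
«either `R` consists of exactly two `Γ`-orbits `O` and `−O` … In the former case `O` is called asymmetric»).
[cite: LanglandsShelstad1987, §2.1 (reissue p. 12)] -/
def IsAsymmOrbit (O : Set X) : Prop := (∃ l : X, O = MulAction.orbit S l) ∧ -O ≠ O

variable (X) in
/-- `Γ_{+λ} = {σ ∈ Γ : σλ = λ}` (reissue p. 19) — Mathlib's stabiliser. [cite: LanglandsShelstad1987, §2.5 (reissue p. 19)] -/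
abbrev stabPlus (l : X) : Subgroup S := MulAction.stabilizer S l

variable (X) in
/-- `Γ_{±λ} = {σ ∈ Γ : σλ = ±λ}` (reissue p. 19): the stabiliser of the pair `{λ, −λ} ⊆ X` for the pointwise
action (since `σ(−λ) = −σλ`, `σ` stabilises the pair iff `σλ = ±λ`). [cite: LanglandsShelstad1987, §2.5 (reissue p. 19)] -/
def stabPM (l : X) : Subgroup S := MulAction.stabilizer S ({l, -l} : Set X)

/-! ### (2.2) a-data and the cochains `u_p`, `v_p` (reissue pp. 12–13) -/

variable (K : Type w) [Field K] [MulSemiringAction S K]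

/-- The action of `σ` on `K^×` induced by its action on the field `K` (print: «an extension of the action of `Σ` on
`k` to `k̄`», reissue p. 12). [cite: LanglandsShelstad1987, §2.2 (reissue p. 12)] -/
def unitsGalAct (σ : S) : Kˣ →* Kˣ := Units.map ((MulSemiringAction.toRingHom S K σ : K →+* K) : K →* K)

variable (X) in
/-- The DIAGONAL action of `σ ∈ Σ` on `K^× ⊗ X`, `a^λ ↦ σ(a)^{σλ}` (reissue pp. 12–13, used in `∂u_p`), as an explicit
`ℤ`-linear endomorphism of `X ⊗[ℤ] Additive Kˣ` (no instance: convention (C5)). [cite: LanglandsShelstad1987, §2.2 (reissue p. 13)] -/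
def actDiag (σ : S) : UnitsTensor X K →ₗ[ℤ] UnitsTensor X K :=
  TensorProduct.map (DistribSMul.toAddMonoidHom X σ).toIntLinearMap
    (MonoidHom.toAdditive (unitsGalAct S K σ)).toIntLinearMap

variable (X) in
/-- **a-data** «for the action of `Γ` on `R`» (reissue pp. 12–13): «(i) `a_λ ∈ k̄^×` and `a_{σλ} = σ(a_λ)`, `σ ∈ Γ`,
`λ ∈ R`, and (ii) `a_{−λ} = −a_λ`, `λ ∈ R`» — a function `a : X → Kˣ` constrained on `R`.
[cite: LanglandsShelstad1987, §2.2 (reissue pp. 12–13)] -/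
def IsAData (R : Finset X) (a : X → Kˣ) : Prop :=
  (∀ σ : S, ∀ l ∈ R, (a (σ • l) : K) = σ • (a l : K)) ∧ ∀ l ∈ R, (a (-l) : K) = -(a l : K)

variable (X) in
/-- The datum of Lemma 2.2.B (reissue p. 13): «`{b_λ : λ ∈ R}` satisfies `b_λ ∈ k̄^×`, `b_{σλ} = σ(b_λ)`, `σ ∈ Γ`, and
`b_{−λ} = b_λ`». [cite: LanglandsShelstad1987, Lemma 2.2.B (reissue p. 13)] -/
def IsBData (R : Finset X) (b : X → Kˣ) : Prop :=
  (∀ σ : S, ∀ l ∈ R, (b (σ • l) : K) = σ • (b l : K)) ∧ ∀ l ∈ R, b (-l) = b l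

/-- **`u_p(σ) = ∏^p_{1,σ} a_λ^λ`** (reissue p. 13), the product (sum) over `λ ∈ R` with `p(λ) = 1`, `p(σ⁻¹λ) = −1`;
a 1-cochain of `Γ` in `k̄^× ⊗ X`. [cite: LanglandsShelstad1987, §2.2 (reissue p. 13)] -/
def uCochain (R : Finset X) (p : X → ℤˣ) (a : X → Kˣ) (σ : S) : UnitsTensor X K :=
  ∑ l ∈ R with (p l = 1 ∧ p (σ⁻¹ • l) = -1), unitPow (a l) l

/-- **`v_p(σ) = ∏^p_{1,σ} b_λ^λ`** (reissue p. 13, Lemma 2.2.B) — the same formula as `u_p`, for the datum `b`.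
[cite: LanglandsShelstad1987, Lemma 2.2.B (reissue p. 13)] -/
def vCochain (R : Finset X) (p : X → ℤˣ) (b : X → Kˣ) (σ : S) : UnitsTensor X K :=
  ∑ l ∈ R with (p l = 1 ∧ p (σ⁻¹ • l) = -1), unitPow (b l) l

/-- The inhomogeneous coboundary of a 1-cochain `c` of `Σ` for the DIAGONAL action on `K^× ⊗ X`:
`∂c(σ, τ) = σ·c(τ) − c(στ) + c(σ)` (additively; print p. 13: «`∂u_p(σ,τ) = u_p(σ)σ(u_p(τ))u_p(στ)⁻¹`», and the
convention of Mathlib's `groupCohomology.IsCoboundary₂`). [cite: LanglandsShelstad1987, §2.2 (reissue p. 13)] -/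
def cobdDiag (c : S → UnitsTensor X K) (σ τ : S) : UnitsTensor X K :=
  actDiag S X K σ (c τ) - c (σ * τ) + c σ

end GaugeCarriers

/-! ## Part B. (1.2) endoscopic data over `LGroupData` (reissue p. 7) -/

section Endoscopy

variable {F : Type*} [Field F]

/-- **Endoscopic data `(H, ℋ, s, ξ)` for `G`** (reissue p. 7), in the case «`ℋ = ᴸH`» that print adopts until (4.4),
over the tree's Galois-form L-group data `L = (Ĝ, ρ_G)`, `ᴸG = Ĝ ⋊ Γ_F`:
* `H` — the L-group datum `(Ĥ, ρ_H)` of the endoscopic group (print (ii): «`ℋ` is a split extension of `W_F` by `Ĥ`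
  … and `ρ_ℋ` coincides with `ρ_H`» — automatic for `ℋ = ᴸH`);
* `s` — «(iii) `s` is a semisimple element of `Ĝ`» (`s_semisimple`, the tree's matrix idiom);
* `ξ : ᴸH → ᴸG` — «(iv) an L-homomorphism, that is, a homomorphism of extensions» (`rightHom_ξ`), such that
  «(a) `Int s ∘ ξ = a ⊗ ξ`, where `a` is … a trivial 1-cocycle of `W_F` in `Z(Ĝ)` if `F` is local», `a ⊗ ξ(h) =
  a(w(h))ξ(h)` — recorded as: `a(σ) = z·σ(z)⁻¹` for some `z ∈ Z(Ĝ)` (`exists_center`; the LOCAL condition), and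
  «(b) `ξ|_Ĥ` is an isomorphism of `Ĥ` with the connected component of the centralizer of `s` in `Ĝ`»
  (`ξ_inl_injective`, `range_ξ_inl`; identity component for the topology of `Ĝ ≤ GL_N(ℂ)`).
Not recorded (no `F`-groups in Mathlib): (i) «`H` is a quasi-split group over `F`» with `ᴸH` ITS L-group; the
global variant of (a) («locally trivial»). [cite: LanglandsShelstad1987, §1.2 (reissue p. 7)] -/
structure EndoscopicDatum (L : LGroupData F) where
  /-- The L-group datum `(Ĥ, ρ_H)` of the endoscopic group. -/
  H : LGroupData F
  /-- The semisimple element `s ∈ Ĝ`. -/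
  s : L.dual
  /-- `s` is semisimple (as a matrix in `GL_N(ℂ)`). -/
  s_semisimple : Module.End.IsSemisimple
    (Matrix.toLin' (((s : GL (Fin L.rank) ℂ)) : Matrix (Fin L.rank) (Fin L.rank) ℂ))
  /-- The L-homomorphism `ξ : ᴸH → ᴸG`. -/
  ξ : H.LGroup →* L.LGroup
  /-- `ξ` is a homomorphism of extensions of `Γ_F`. -/
  rightHom_ξ : ∀ x : H.LGroup, (ξ x).right = x.right
  /-- (iv)(a), local: `Int s ∘ ξ = a ⊗ ξ` with `a(σ) = z σ(z)⁻¹`, `z ∈ Z(Ĝ)`. -/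
  exists_center : ∃ z : L.dual, z ∈ Subgroup.center L.dual ∧ ∀ x : H.LGroup,
    SemidirectProduct.inl s * ξ x * (SemidirectProduct.inl s)⁻¹ =
      SemidirectProduct.inl (z * (L.galAct x.right z)⁻¹) * ξ x
  /-- (iv)(b): `ξ` is injective on `Ĥ`. -/
  ξ_inl_injective : Function.Injective fun h : H.dual => ξ (SemidirectProduct.inl h)
  /-- (iv)(b): `ξ(Ĥ) = Cent(s, Ĝ)⁰`. -/
  range_ξ_inl : Set.range (fun h : H.dual => (ξ (SemidirectProduct.inl h)).left) =
    Subtype.val '' (Subgroup.connectedComponentOfOne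
      (Subgroup.centralizer ({s} : Set L.dual)) : Set (Subgroup.centralizer ({s} : Set L.dual)))

/-- «`Z(ξ′)`, the centralizer in `Ĝ` of the image of `ℋ′` under `ξ′`» (reissue p. 7, equivalence of endoscopic
data (iii)): the elements of `Ĝ` commuting in `ᴸG` with every `ξ(x)`, as the preimage under `Ĝ → ᴸG` of the
centralizer of the image. [cite: LanglandsShelstad1987, §1.2 (reissue p. 7)] -/
def EndoscopicDatum.centralizerImage {L : LGroupData F} (E : EndoscopicDatum L) : Subgroup L.dual :=
  (Subgroup.centralizer (Set.range fun x : E.H.LGroup => E.ξ x)).comap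
    (SemidirectProduct.inl : L.dual →* L.LGroup)

/-- The part of «equivalence of endoscopic data» (reissue p. 7) that is expressible on `(Ĥ, s, ξ)`: an
L-isomorphism `β : ᴸH′ → ᴸH` over `Γ_F` and `g ∈ Ĝ` with «(ii) `Int g ∘ ξ ∘ β = ξ′`» and «(iii) `g s g⁻¹` lies in
`Z(Ĝ)Z(ξ′)⁰ s′`, where `Z(ξ′)` is the centralizer in `Ĝ` of the image of `ℋ′` under `ξ′`» (`Z(ξ′)⁰`: identity
component for the topology of `Ĝ ≤ GL_N(ℂ)`).  Print's (i) (an `F`-isomorphism `α : H → H′` with `α`, `β` dual on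
based root data) is NOT expressible here (no `F`-groups) and is omitted — this is only the `(β, g)`-half of print's
relation, recorded under a distinct name. [cite: LanglandsShelstad1987, §1.2 (reissue p. 7)] -/
def EndoscopicDatum.IsLEquiv {L : LGroupData F} (E E' : EndoscopicDatum L) : Prop :=
  ∃ (β : E'.H.LGroup ≃* E.H.LGroup) (g : L.dual),
    (∀ x, (β x).right = x.right) ∧
    (∀ x, SemidirectProduct.inl g * E.ξ (β x) * (SemidirectProduct.inl g)⁻¹ = E'.ξ x) ∧
    ∃ (z : L.dual) (c : E'.centralizerImage), z ∈ Subgroup.center L.dual ∧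
      c ∈ Subgroup.connectedComponentOfOne E'.centralizerImage ∧
      g * E.s * g⁻¹ = z * (c : L.dual) * E'.s

end Endoscopy

/-! ## Part C. (1.3) point correspondences — interface (reissue pp. 8–9) -/

section Points

/-- **Point-correspondence vocabulary of (1.3)** for a pair `(H, G)` (`H` endoscopic for `G`) over `F` with
`Γ = Gal(F̄/F)`, as an explicit INTERFACE (no properties): the carriers are the groups of rational points
`HF = H(F)`, `GF = G(F)`, the sets `CH`, `CG` of semisimple conjugacy classes in `H(F̄)`, `G(F̄)` with their
`Γ`-actions («The group `Γ = Gal(F̄/F)` acts on conjugacy classes», p. 8), the canonical map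
«`A_{H/G} : Cℓ_ss(H(F̄)) → Cℓ_ss(G(F̄))`» (p. 8), the class maps `H(F) → CH`, `G(F) → CG` on semisimple elements,
and the predicates print defines from them: semisimple ∕ regular ∕ strongly regular («elements whose centralizer is
a torus», p. 8) in `G(F)` and `H(F)`, «`G`-regular» ∕ «strongly `G`-regular» in `H(F)` (p. 8), stable conjugacy in
`H(F)` and in `G(F)`, and «`γ_H` is an image of `γ_G`» (p. 9).  Consumers state printed facts as `Prop`s ON a
given `P` (see `Preliminaries.lean`); nothing is asserted for all `P`. [cite: LanglandsShelstad1987, §1.3 (reissue pp. 8–9)] -/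
structure PointCorrespondence (Γ : Type u) (HF : Type v) (GF : Type w) [Group Γ] [Group HF] [Group GF] where
  /-- Semisimple conjugacy classes in `H(F̄)`. -/
  CH : Type v
  /-- Semisimple conjugacy classes in `G(F̄)`. -/
  CG : Type w
  /-- The action of `Γ` on `Cℓ_ss(H(F̄))`. -/
  galH : Γ → CH → CH
  /-- The action of `Γ` on `Cℓ_ss(G(F̄))`. -/
  galG : Γ → CG → CG
  /-- `A_{H/G} : Cℓ_ss(H(F̄)) → Cℓ_ss(G(F̄))`. -/
  AHG : CH → CG
  /-- Semisimple elements of `H(F)`. -/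
  IsSemisimpleH : HF → Prop
  /-- Semisimple elements of `G(F)`. -/
  IsSemisimpleG : GF → Prop
  /-- The `H(F̄)`-conjugacy class of a (semisimple) element of `H(F)`. -/
  classH : HF → CH
  /-- The `G(F̄)`-conjugacy class of a (semisimple) element of `G(F)`. -/
  classG : GF → CG
  /-- Regular semisimple elements of `G(F)`. -/
  IsRegularG : GF → Prop
  /-- Strongly regular elements of `G(F)` (centralizer a torus). -/
  IsStronglyRegularG : GF → Prop
  /-- Strongly regular elements of `H(F)`. -/
  IsStronglyRegularH : HF → Prop
  /-- Classes in `Cℓ_ss(G(F̄))` consisting of regular semisimple elements. -/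
  IsRegularClassG : CG → Prop
  /-- Classes in `Cℓ_ss(G(F̄))` consisting of strongly regular elements. -/
  IsStronglyRegularClassG : CG → Prop
  /-- Stable conjugacy in `H(F)`. -/
  stConjH : HF → HF → Prop
  /-- Stable conjugacy in `G(F)`. -/
  stConjG : GF → GF → Prop
  /-- «`γ_H` is an image of `γ_G`» (p. 9), for `G`-regular semisimple `γ_H ∈ H(F)`, regular semisimple `γ_G ∈ G(F)`. -/
  IsImage : HF → GF → Prop

namespace PointCorrespondence

variable {Γ : Type u} {HF : Type v} {GF : Type w} [Group Γ] [Group HF] [Group GF]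
variable (P : PointCorrespondence Γ HF GF)

/-- «We call semisimple `γ_H ∈ H(F)` `G`-regular if the image of its conjugacy class under `A_{H/G}` consists of
regular semisimple elements» (reissue p. 8) — DEFINED from the interface. [cite: LanglandsShelstad1987, §1.3 (reissue p. 8)] -/
def IsGRegular (γH : HF) : Prop := P.IsSemisimpleH γH ∧ P.IsRegularClassG (P.AHG (P.classH γH))

/-- «… and strongly `G`-regular if the image consists of strongly regular elements, that is, elements whose
centralizer is a torus» (reissue p. 8). [cite: LanglandsShelstad1987, §1.3 (reissue p. 8)] -/
def IsStronglyGRegular (γH : HF) : Prop := P.IsSemisimpleH γH ∧ P.IsStronglyRegularClassG (P.AHG (P.classH γH))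

/-- «`A_{H/G}` is a `Γ`-map» (the content of Lemma 1.3.A, reissue p. 8) as a predicate on the interface.
[cite: LanglandsShelstad1987, Lemma 1.3.A (reissue p. 8)] -/
def IsGammaMap : Prop := ∀ (σ : Γ) (c : P.CH), P.AHG (P.galH σ c) = P.galG σ (P.AHG c)

end PointCorrespondence

end Points

end Literature.NumberTheory.Automorphic.LanglandsShelstad1987

end
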